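import Summits.KontsevichZagierPeriods.Zeta5Search.WedgeDictionaryLevelDescent
import HarnessLib

/-!
# Level descent (LD@N): the symmetric weight, its cross-contiguity and the face value — the WEIGHT SIDE of the inductive proof, I: definitions, statements, re-indexing

HONEST FRAMING: systematic search; no irrationality claim unless certified.

OUR work (Summit side; planner gen-1 g7, 2026-08-20; memo `pub-zeta5-gen-1/D2-LD-PROOF-g7.md` §3–§5b).  The WEIGHT SIDE of the level-descent proof design, part 1 of 2: the symmetric weight and its re-indexing `ldWeight_eq_sym_stmt` (PROVED here, `ldWeight_eq_sym`),
and the three statements `ldW_cross_stmt`, `ldW_twoTerm_stmt`, `ldW_face_stmt` (tagged `@[conjecture]` as the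
provenance record; PROVED BY NAME in the companion file `WedgeDictionaryLevelDescentWeightsProof.lean`, staged together: `ldW_cross`, `ldW_twoTerm`, `ldW_face`);
the SERIES-side face value `coeffU_faceExt_stmt` is a genuine open `@[conjecture]` PROOF TARGET (INTERNALLY MINTED — exact instances only until proved). Everything is an identity between rational numbers.  Companion of
`G7CrossContiguity.lean` ((L1) mixed relation, (L2) cross-contiguity of the wedges).  This file imports the level-descent statement file (T1,
`WedgeDictionaryLevelDescent`: `ldWeight`, `degShape`, `facQ`, `levelDescentW`, `levelDescentV`) and adds:

* `ldWeightSym b m` — the weight in the index `m = b₇ − i` (the value of the lowered slot of `degShape b i`):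
  `Ω(b;m) = 2(−1)^{m+Σ_B b_j}·d!·∏_{t∈{1,2,7}} [b_t!/((b_t−m)!·∏_{j∈B} c_tj!)]·∏_{j∈B} (N−b_j−m)! / [m!·(2N−Σ_B b_j−m)!·(N+m−σ)!]`, `B = {3,4,5,6}`,
  `σ = b₁+b₂+b₇` — manifestly symmetric in the slot triple {1,2,7}; `ldWeight b i = ldWeightSym b (b₇ − i)` for all `b, i` (`ldWeight_eq_sym`: the same
  multiset of factorials, exponent of −1 shifted by the even number `2(N − b₆ + b₇ − m)`).
* `ldSupp b m` / `ldW b m` — the TRUE support (all `c_tj ≥ 0`, `max(σ−N,0) ≤ m ≤ min(b₁,b₂,b₇)`) and the truncated weight (`facQ` of a negative integer is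
  `1`, not `0`, so the truncation must be explicit once the induction leaves the box).
* STATED here, PROVED in the companion file: `ldW_cross` ((L3): `(b₂−b₇)(d+1)·ldW b m = b₂Π₂·ldW (b−e₂) m − b₇Π₇·ldW (b−e₇) m` for every `m`, memo §3 incl. the edge cases),
  `ldW_twoTerm` (the row `b₇ = 0` version used by the wide ζ(3)-row, memo §5b), `ldW_face` (on the face `b₁+b₂ = N` only `m = b₇` survives, with the value (F));
  tools (companion file): `facQ_succ`, `ldWeightSym_eq` (numerator/denominator form), the step lemmas `ldStep2`/`ldStep7`
  (`b_s·∏_B(c_sj+1)·(N+m−σ+1)·Ω(b−e_s;m) = (d+1)(b_s−m)·Ω(b;m)`) and their doubly-lowered versions.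
* PROOF TARGET (@[conjecture], series side, for `WedgeDictionaryLevelDescentProof`): `coeffU_faceExt_stmt` ((F): `U(b) = 2(−1)^{Σ_{j≥3} b_j} b₁! b₂!/∏_{j=3}^{7}(c_1j! c_2j!)`
  for `b₁ + b₂ = N`, `b₁ ≠ b₂` allowed — extends `coeffU_face_closed`; INTERNALLY MINTED — exact instances only until proved).
Evidence: `ldWeightSym` = g6's `Om` on 55/55 shapes and the full identities of memo §6 (`code/gen1/g7/x2_ld.py`, `x4_slice.py`); transcription examples run in
staging with `native_decide` (kept out of the filed text).  What this is NOT: the level-descent identity itself (that needs (L1), (L2), the series-side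
face value and the induction, `WedgeDictionaryLevelDescentProof`), or a statement about irrationality.
-/

open Finset

namespace Summit.KontsevichZagierPeriods.Zeta5Search.WedgeDictionary

open Summit.KontsevichZagierPeriods.Zeta5Search.DualSeries

/-- `Σ_{j∈B} b_j`, `B = {3,4,5,6}`. -/
def sumB (b : ℕ → ℤ) : ℤ := b 3 + b 4 + b 5 + b 6

/-- `σ = b₁ + b₂ + b₇` (the slot triple). -/
def sigmaT (b : ℕ → ℤ) : ℤ := b 1 + b 2 + b 7

/-- The symmetric level-descent weight `Ω(b;m)` (module docstring). -/
def ldWeightSym (b : ℕ → ℤ) (m : ℤ) : ℚ :=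
  let c : ℕ → ℕ → ℤ := fun j k => b 0 - b j - b k
  2 * (-1 : ℚ) ^ (m + sumB b) * facQ (dOf b) *
      (∏ t ∈ ({1, 2, 7} : Finset ℕ), (facQ (b t) / (facQ (b t - m) * ∏ j ∈ Icc 3 6, facQ (c t j)))) *
      (∏ j ∈ Icc 3 6, facQ (b 0 - b j - m)) /
    (facQ m * facQ (2 * b 0 - sumB b - m) * facQ (b 0 + m - sigmaT b))

/-- The true support of the weight: all `c_tj ≥ 0` (`t` in the triple, `j ∈ B`) and `max(σ−N, 0) ≤ m ≤ min(b₁, b₂, b₇)`. -/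
def ldSupp (b : ℕ → ℤ) (m : ℤ) : Prop :=
  (∀ t ∈ ({1, 2, 7} : Finset ℕ), ∀ j ∈ Icc 3 6, 0 ≤ b 0 - b t - b j) ∧
    0 ≤ m ∧ sigmaT b - b 0 ≤ m ∧ m ≤ b 1 ∧ m ≤ b 2 ∧ m ≤ b 7

/-- `ldSupp` is decidable (finite conjunction of integer inequalities). -/
instance (b : ℕ → ℤ) (m : ℤ) : Decidable (ldSupp b m) := by unfold ldSupp; infer_instance

/-- The truncated weight (zero off the true support). -/
def ldW (b : ℕ → ℤ) (m : ℤ) : ℚ := if ldSupp b m then ldWeightSym b m else 0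

/-- STATEMENT (PROVED below, `ldWeight_eq_sym`): `ldWeight` is the symmetric weight re-indexed (all `b`, `i`; pure rearrangement of the same factorials). -/
def ldWeight_eq_sym_stmt : Prop := ∀ (b : ℕ → ℤ) (i : ℤ), ldWeight b i = ldWeightSym b (b 7 - i)

/-- STATEMENT (L3, memo §3; PROVED in the companion file `WedgeDictionaryLevelDescentWeightsProof` as `ldW_cross`; the tag records provenance): the truncated weights satisfy the cross-contiguity relation of the wedges TERMWISE in `m`, on the extended region
(`B` in the box, triple slots in `[0, N]`, `d ≥ 0`, `b₂, b₇ ≥ 1`).  Interior case = the one-line identity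
`(c₁₂+1)(b₂−m) − (c₁₇+1)(b₇−m) = (b₂−b₇)(N+1+m−σ)`; edge cases: a term leaving the support meets a vanishing coefficient (memo §3). -/
@[conjecture] def ldW_cross_stmt : Prop :=
  ∀ (b : ℕ → ℤ) (m : ℤ), 0 ≤ b 0 → (∀ j ∈ Icc 1 7, 0 ≤ b j ∧ b j ≤ b 0) → (∀ j ∈ Icc 3 6, 2 * b j ≤ b 0) → 0 ≤ dOf b →
    1 ≤ b 2 → 1 ≤ b 7 →
    ((b 2 : ℚ) - b 7) * ((dOf b : ℚ) + 1) * ldW b m =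
      (b 2 : ℚ) * (∏ j ∈ ({1, 3, 4, 5, 6} : Finset ℕ), ((b 0 : ℚ) - b 2 - b j + 1)) * ldW (Function.update b 2 (b 2 - 1)) m -
        (b 7 : ℚ) * (∏ j ∈ ({1, 3, 4, 5, 6} : Finset ℕ), ((b 0 : ℚ) - b 7 - b j + 1)) * ldW (Function.update b 7 (b 7 - 1)) m

/-- STATEMENT (memo §5b; PROVED in the companion file as `ldW_twoTerm`; the two-term branch of the wide ζ(3)-row): on the row `b₇ = 0` only `m = 0` survives and
`(d+1)·ldW b 0 = Π₂·ldW (b−e₂) 0`, `Π₂ = ∏_{j∈{1,3,4,5,6}} (c_2j + 1)`. -/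
@[conjecture] def ldW_twoTerm_stmt : Prop :=
  ∀ (b : ℕ → ℤ), 0 ≤ b 0 → (∀ j ∈ Icc 1 7, 0 ≤ b j ∧ b j ≤ b 0) → (∀ j ∈ Icc 3 6, 2 * b j ≤ b 0) → 0 ≤ dOf b →
    1 ≤ b 2 → b 7 = 0 →
    ((dOf b : ℚ) + 1) * ldW b 0 =
      (∏ j ∈ ({1, 3, 4, 5, 6} : Finset ℕ), ((b 0 : ℚ) - b 2 - b j + 1)) * ldW (Function.update b 2 (b 2 - 1)) 0

/-- The face value (F): `2(−1)^{Σ_{j=3}^{7} b_j}·b₁!·b₂! / ∏_{j=3}^{7} (c_1j!·c_2j!)`. -/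
def faceValue (b : ℕ → ℤ) : ℚ :=
  2 * (-1 : ℚ) ^ (sumB b + b 7) * facQ (b 1) * facQ (b 2) /
    ∏ j ∈ Icc 3 7, (facQ (b 0 - b 1 - b j) * facQ (b 0 - b 2 - b j))

/-- STATEMENT (L4 weight side; PROVED in the companion file as `ldW_face`): on the face `b₁ + b₂ = N` the truncated weight is the single term `m = b₇` with the value (F)
(and vanishes for `m ≠ b₇`, and altogether if `b₇ > min(b₁,b₂)` or some `c_tj < 0`). -/
@[conjecture] def ldW_face_stmt : Prop :=
  ∀ (b : ℕ → ℤ) (m : ℤ), 0 ≤ b 0 → (∀ j ∈ Icc 1 7, 0 ≤ b j ∧ b j ≤ b 0) → 0 ≤ dOf b → b 1 + b 2 = b 0 →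
    ldW b m = if m = b 7 ∧ ldSupp b (b 7) then faceValue b else 0

/-- All `c_1j, c_2j ≥ 0` for `j = 3..7` (the face value is nonzero exactly then). -/
def faceSupp (b : ℕ → ℤ) : Prop := ∀ j ∈ Icc 3 7, 0 ≤ b 0 - b 1 - b j ∧ 0 ≤ b 0 - b 2 - b j

/-- `faceSupp` is decidable (finite conjunction of integer inequalities). -/
instance (b : ℕ → ℤ) : Decidable (faceSupp b) := by unfold faceSupp; infer_instance

/-- PROOF TARGET (L4, extends `coeffU_face_closed` to `b₁ ≠ b₂`; INTERNALLY MINTED — exact instances only until proved): on the extended face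
`b₁ + b₂ = N` (all slots in `[0, N]`, `d ≥ 0`), `U(b) = faceValue b` if every `c_1j, c_2j ≥ 0` (`j = 3..7`), and `U(b) = 0` otherwise. -/
@[conjecture] def coeffU_faceExt_stmt : Prop :=
  ∀ (b : ℕ → ℤ), 0 ≤ b 0 → (∀ j ∈ Icc 1 7, 0 ≤ b j ∧ b j ≤ b 0) → 0 ≤ dOf b → b 1 + b 2 = b 0 →
    coeffU b = if faceSupp b then faceValue b else 0

/-! ## gen-1 g7: kernel proof of the re-indexing `ldWeight b i = ldWeightSym b (b₇ − i)` (all `b`, `i`). -/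

/-- `Icc 3 6 = {3,4,5,6}` (index bookkeeping for the slots `j ∈ B`). -/
theorem Icc_three_six : (Icc 3 6 : Finset ℕ) = {3, 4, 5, 6} := by decide

/-- Sign bookkeeping: `(−1)^{e+2k} = (−1)^e`. -/
theorem neg_one_zpow_add_even (e k : ℤ) : (-1 : ℚ) ^ (e + 2 * k) = (-1 : ℚ) ^ e := by
  rw [zpow_add₀ (by norm_num : (-1 : ℚ) ≠ 0), zpow_mul]
  norm_num

/-- The printed weight equals its symmetric rewrite at the reflected index: `ldWeight b i = ldWeightSym b (b 7 − i)`
for ALL `b`, `i` (same factorial arguments one by one; signs differ by an even exponent). -/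
theorem ldWeight_eq_sym (b : ℕ → ℤ) (i : ℤ) : ldWeight b i = ldWeightSym b (b 7 - i) := by
  -- the sign exponents differ by the even integer 2(b₀ − b₆ + i)
  have hsign : (-1 : ℚ) ^ (b 0 - b 1 - b 6 + (b 0 - b 2 - b 6) + i + ∑ j ∈ range 7, b (j + 1)) =
      (-1 : ℚ) ^ (b 7 - i + sumB b) := by
    have : b 0 - b 1 - b 6 + (b 0 - b 2 - b 6) + i + ∑ j ∈ range 7, b (j + 1) =
        (b 7 - i + sumB b) + 2 * (b 0 - b 6 + i) := by
      simp only [sumB, sum_range_succ, sum_range_zero]; ring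
    rw [this, neg_one_zpow_add_even]
  -- integer arguments of the factorials, aligned one by one
  have e1 : b 1 - (b 7 - i) = b 1 - b 7 + i := by ring
  have e2 : b 2 - (b 7 - i) = b 2 - b 7 + i := by ring
  have e7 : b 7 - (b 7 - i) = i := by ring
  have e3 : ∀ j : ℕ, b 0 - b j - (b 7 - i) = b 0 - b j - b 7 + i := fun j => by ring
  have e4 : ∀ j : ℕ, b 0 - b 7 - b j = b 0 - b j - b 7 := fun j => by ring
  have e5 : 2 * b 0 - sumB b - (b 7 - i) = dOf b - (b 0 - b 1 - b 2) + i := by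
    simp only [sumB, dOf, sum_range_succ, sum_range_zero]; ring
  have e6 : b 0 + (b 7 - i) - sigmaT b = b 0 - b 1 - b 2 - i := by
    simp only [sigmaT]; ring
  simp only [ldWeight, ldWeightSym]
  rw [hsign, Icc_three_six]
  simp only [prod_insert, mem_insert, mem_singleton, prod_singleton, Nat.reduceEqDiff, or_self,
    not_false_eq_true]
  rw [e1, e2, e7, e3 3, e3 4, e3 5, e3 6, e4 3, e4 4, e4 5, e4 6, e5, e6]
  ring

/-- The re-indexing statement, by name. -/
theorem ldWeight_eq_sym_holds : ldWeight_eq_sym_stmt := ldWeight_eq_sym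

end Summit.KontsevichZagierPeriods.Zeta5Search.WedgeDictionary
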